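import Summits.BirchSwinnertonDyer.BirchSwinnertonDyer.Theorems.ByReductionTypeAtTwoMultiplicativeInputs
import HarnessLib

/-!
# Route `ByReductionTypeAtTwo`, multiplicative node — the layer-2 GLUE item
(stmt-BirchSwinnertonDyer-19924, `MultiplicativeRankZeroAtTwoOfChildren`)

The glued split (gen 1) of the crux `MultiplicativeRankZeroAtTwo` (stmt-BirchSwinnertonDyer-19096)
into the support `MultPublishedInputsAtTwo` (Gross–Zagier–Kolyvagin, the tree's named fact
`rank_eq_analyticRank_of_analyticRank_le_one`) and the two cruxes `MultUpperHalfAtTwo`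
(`ord₂ #Ш ≤ ord₂ #Ш_an`, Miller's currency `Typed.MissingUpperBoundAt W 2`) and `MultLowerHalfAtTwo`
(`ord₂ #Ш_an ≤ ord₂ #Ш`, `Typed.MissingLowerBoundAt W 2`), each ∀-closed over non-CM `E/ℚ` of
analytic rank `0` with multiplicative reduction at `2`.

The glue is ONE application of the landed bridge
`Summit.BirchSwinnertonDyer.BirchSwinnertonDyer.Theorems.multiplicativeRankZeroAtTwo_of_halves`
(p409679, `Theorems/ByReductionTypeAtTwoMultiplicativeInputs.lean`): Miller's last clause by
`missingPPartAt_of_lower_of_upper`, then `BSD(E,2)` by `bsdp_of_missingPPartAt`.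
Composition certificate; nothing asserted, no hypothesis beyond the three children.
-/

namespace Summit.BirchSwinnertonDyer.BirchSwinnertonDyer.Theorems

/-- **Glue (item stmt-BirchSwinnertonDyer-19924).** The three children of the multiplicative node —
`MultPublishedInputsAtTwo` (GZK), `MultUpperHalfAtTwo` (`ord₂ #Ш ≤ ord₂ #Ш_an`) and
`MultLowerHalfAtTwo` (`ord₂ #Ш_an ≤ ord₂ #Ш`) — imply the parent crux
`MultiplicativeRankZeroAtTwo` (BSD₂ for every non-CM `E/ℚ` of analytic rank `0` multiplicative at
`2`), by one application of the bridge `multiplicativeRankZeroAtTwo_of_halves` (p409679).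
[cite: Miller2011LMS, Def 1.1] -/
theorem multiplicativeRankZeroAtTwoOfChildren_holds :
    Summit.BirchSwinnertonDyer.BirchSwinnertonDyer.Theses.ByReductionTypeAtTwo.MultiplicativeRankZeroAtTwoOfChildren := by
  unfold Summit.BirchSwinnertonDyer.BirchSwinnertonDyer.Theses.ByReductionTypeAtTwo.MultiplicativeRankZeroAtTwoOfChildren
  intro hGZK hU hL
  exact multiplicativeRankZeroAtTwo_of_halves hGZK hU hL

end Summit.BirchSwinnertonDyer.BirchSwinnertonDyer.Theorems
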